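import Summits.Ventures.PercRepro.GenQFlatFacts
import Summits.Ventures.PercRepro.GenQSolidDemandFree

/-!
# PercRepro — the three per-flat row templates of the type-`t` LP, for every rank (night-4, gen 7)

The rows of record of the `(8, 6)` cell's `t = 5` layer that refine the profile by the rank-`4` flats —
(R5a) `DFq_five_ge_big_solids`, (R5b) `DFq_five_ge_solids`, (S6q) `sum_solids_kappa4_le` — are each
«a generic counting identity over the rank-`r` flats» composed with «a per-flat lower bound by a knapsack».
This file states the three generic halves for every rank `r` and type `t`, with the per-flat bound as a hypothesis
on an arbitrary function of `s = |F ∩ G|`: the per-flat functions (`κ_r`, `ρ_t`, `c_t`) are the ONE size-dependent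
input of these rows at every level — at `(9, 7)` the instances `r = 5`, `t = 6` (sheet §61 (g)).

* `sum_flats_fn_eq`: `Σ_{F ∈ flatsQ M r} f(|F ∩ G|) = Σ_s f(s)·NR r s` (grouping by the number of points);
* `NR_eq_zero_of_flats_le`, `BR_eq_zero_of_flats_le`: the atoms vanish above the flat bound;
* (S6r) `sum_flats_kappa_le`: `κ(|F ∩ G|) ≤ #{A ⊆ F ∩ G : |A| = r, rk A = r}` on every rank-`r` flat ⇒
  `Σ_s κ(s)·NR r s ≤ C(|G|, r)`;
* (Rtb) `DFq_add_choose_ge_flat_rows`: `ρ(|F ∩ G|) ≤ #{A ⊆ F ∩ G : |A| = t, rk A = t − 1}` on every rank-`(t−1)`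
  flat ⇒ `#{|G ∖ S| < t} + #{|G ∖ S| = t} + Σ_s ρ(s)·NR (t−1) s ≤ DF_t + C(|G|, t)`;
* `goodSets`, `sum_goodSets_le`, (Rta) `DFq_ge_flat_good_rows`: the `t`-subsets of `F ∩ G` of rank `t − 1` with
  spanning complement are demand-free level-`t` sets, distinct across flats; `c(|F ∩ G|) ≤ #goodSets` ⇒
  `#{|G ∖ S| < t} + Σ_s c(s)·NR (t−1) s ≤ DF_t`.

Imports `GenQFlatFacts` (`NR`, `BR`) and `GenQSolidDemandFree` (`coSpan`, `DFq_ge_levels_add_rank_le`,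
`DFq_add_choose_ge_of_flats`, `card_rank_eq_eq_sum_flats`).
-/
namespace PercRepro.Night4

open Finset ThmH SixFour GenQ PerFlat Star

variable {α : Type*} [DecidableEq α] {M : Matroid α} [M.Finite]

/-! ## Grouping the rank-`r` flats by their number of points of `G` -/

/-- `Σ_{F ∈ flatsQ M r} f(|F ∩ G|) = Σ_{s ≤ |G|} f(s)·NR r s`. -/
theorem sum_flats_fn_eq (G : Finset α) (r : ℕ) (f : ℕ → ℕ) :
    ∑ F ∈ flatsQ M r, f (F ∩ G).card = ∑ s ∈ Finset.range (G.card + 1), f s * NR M G r s := by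
  rw [← Finset.sum_fiberwise_of_maps_to (s := flatsQ M r) (t := Finset.range (G.card + 1))
    (g := fun F : Finset α => (F ∩ G).card) (fun F _ => Finset.mem_coe.2 (Finset.mem_range.2
      (Nat.lt_succ_of_le (Finset.card_le_card Finset.inter_subset_right))))]
  apply Finset.sum_congr rfl
  intro s _
  unfold NR
  rw [Finset.card_eq_sum_ones, Finset.mul_sum]
  apply Finset.sum_congr rfl
  intro F hF
  rw [(Finset.mem_filter.1 hF).2, mul_one]

/-- `NR r s = 0` above the flat bound: no rank-`r` flat has more than `b` points. -/
theorem NR_eq_zero_of_flats_le {r b : ℕ} (hflat : ∀ F ∈ flatsQ M r, F.card ≤ b) (G : Finset α) {s : ℕ}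
    (hs : b < s) : NR M G r s = 0 := by
  unfold NR
  rw [Finset.card_eq_zero, Finset.filter_eq_empty_iff]
  intro F hF h
  have := (Finset.card_le_card (Finset.inter_subset_left (s₂ := G))).trans (hflat F hF)
  omega

/-- `BR q r s = 0` above the flat bound. -/
theorem BR_eq_zero_of_flats_le {r b : ℕ} (hflat : ∀ F ∈ flatsQ M r, F.card ≤ b) (G : Finset α) (q : ℕ) {s : ℕ}
    (hs : b < s) : BR M G q r s = 0 := by
  have h := BR_le (M := M) G q r s
  rw [NR_eq_zero_of_flats_le hflat G hs, mul_zero] at h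
  omega

/-! ## (S6r): the rank-`r` `r`-subsets of `G` lie in the rank-`r` flats, one each -/

/-- **(S6r)** If every rank-`r` flat `F` carries `≥ κ(|F ∩ G|)` rank-`r` `r`-subsets of `F ∩ G`, then
`Σ_s κ(s)·NR r s ≤ C(|G|, r)`: each rank-`r` `r`-subset of `G` lies in exactly one rank-`r` flat. -/
theorem sum_flats_kappa_le {G : Finset α} (hG : G ⊆ gr M) (r : ℕ) (κ : ℕ → ℕ)
    (hκ : ∀ F ∈ flatsQ M r, κ (F ∩ G).card ≤
      (((F ∩ G).powersetCard r).filter (fun A : Finset α => M.eRk (A : Set α) = (r : ℕ∞))).card) :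
    ∑ s ∈ Finset.range (G.card + 1), κ s * NR M G r s ≤ G.card.choose r := by
  rw [← sum_flats_fn_eq]
  calc ∑ F ∈ flatsQ M r, κ (F ∩ G).card
      ≤ ∑ F ∈ flatsQ M r, (((F ∩ G).powersetCard r).filter
          (fun A : Finset α => M.eRk (A : Set α) = (r : ℕ∞))).card := Finset.sum_le_sum hκ
    _ = ((G.powersetCard r).filter (fun A : Finset α => M.eRk (A : Set α) = (r : ℕ∞))).card :=
        (card_rank_eq_eq_sum_flats hG r r).symm
    _ ≤ (G.powersetCard r).card := Finset.card_filter_le _ _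
    _ = G.card.choose r := Finset.card_powersetCard r G

/-! ## (Rtb): the demand-free `t`-subsets through the rank-`(t − 1)` flats -/

/-- **(Rtb)** If every rank-`(t − 1)` flat `F` carries `≥ ρ(|F ∩ G|)` `t`-subsets of `F ∩ G` of rank `t − 1`, then
`#{|G ∖ S| < t} + #{|G ∖ S| = t} + Σ_s ρ(s)·NR (t − 1) s ≤ DF_t + C(|G|, t)`. -/
theorem DFq_add_choose_ge_flat_rows {G : Finset α} (hG : G ⊆ gr M) (q : ℕ) {t : ℕ} (ht : 1 ≤ t) (ρ : ℕ → ℕ)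
    (hρ : ∀ F ∈ flatsQ M (t - 1), ρ (F ∩ G).card ≤
      (((F ∩ G).powersetCard t).filter (fun A : Finset α => M.eRk (A : Set α) = ((t - 1 : ℕ) : ℕ∞))).card) :
    ((Rq M G q).filter (fun S : Finset α => (G \ S).card < t)).card +
      ((Rq M G q).filter (fun S : Finset α => (G \ S).card = t)).card +
      ∑ s ∈ Finset.range (G.card + 1), ρ s * NR M G (t - 1) s ≤ DFq M G q t + G.card.choose t := by
  have h := DFq_add_choose_ge_of_flats (M := M) hG q t ht
  have h2 : ∑ s ∈ Finset.range (G.card + 1), ρ s * NR M G (t - 1) s ≤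
      ∑ F ∈ flatsQ M (t - 1), (((F ∩ G).powersetCard t).filter
        (fun A : Finset α => M.eRk (A : Set α) = ((t - 1 : ℕ) : ℕ∞))).card := by
    rw [← sum_flats_fn_eq]
    exact Finset.sum_le_sum hρ
  omega

/-! ## (Rta): the good sets of a flat — demand-free level-`t` sets, distinct across flats -/

/-- The good `t`-subsets of `F ∩ G` at rank `r`: rank `r` and spanning complement. -/
noncomputable def goodSets (M : Matroid α) [M.Finite] (G F : Finset α) (q t r : ℕ) : Finset (Finset α) :=
  ((F ∩ G).powersetCard t).filter
    (fun A : Finset α => M.eRk (A : Set α) = (r : ℕ∞) ∧ G \ A ∈ Rq M G q)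

/-- The good sets of the rank-`r` flats are distinct `t`-subsets of `G` of rank `≤ r` with spanning complement:
`Σ_F #goodSets F ≤ #{A ∈ coSpan : rk A + 1 ≤ r + 1}`. -/
theorem sum_goodSets_le (G : Finset α) (q t r : ℕ) :
    ∑ F ∈ flatsQ M r, (goodSets M G F q t r).card ≤
      ((coSpan M G q t).filter (fun A : Finset α => M.eRk (A : Set α) + 1 ≤ ((r + 1 : ℕ) : ℕ∞))).card := by
  rw [← Finset.card_sigma]
  apply Finset.card_le_card_of_injOn (fun p => p.2)
  · intro p hp
    rw [Finset.mem_coe, Finset.mem_sigma] at hp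
    obtain ⟨F, A⟩ := p
    simp only at hp ⊢
    unfold goodSets at hp
    rw [Finset.mem_filter, Finset.mem_powersetCard] at hp
    obtain ⟨_, ⟨hAF, hAc⟩, hAr, hsp⟩ := hp
    rw [Finset.mem_coe, Finset.mem_filter]
    unfold coSpan
    rw [Finset.mem_filter, Finset.mem_powersetCard]
    refine ⟨⟨⟨hAF.trans Finset.inter_subset_right, hAc⟩, hsp⟩, ?_⟩
    rw [hAr]
    norm_cast
  · intro p hp p' hp' heq
    rw [Finset.mem_coe, Finset.mem_sigma] at hp hp'
    obtain ⟨F, A⟩ := p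
    obtain ⟨F', A'⟩ := p'
    simp only at heq
    subst heq
    -- `F = cl A = F'`
    have hF := mem_flatsQ.1 hp.1
    have hF' := mem_flatsQ.1 hp'.1
    unfold goodSets at hp hp'
    rw [Finset.mem_filter, Finset.mem_powersetCard] at hp hp'
    have hcl : ∀ {F₀ : Finset α}, F₀ ⊆ gr M → M.IsFlat (F₀ : Set α) → M.eRk (F₀ : Set α) = (r : ℕ∞) →
        A ⊆ F₀ ∩ G → M.closure (A : Set α) = (F₀ : Set α) := by
      intro F₀ _ hfl hr hAF₀
      have hsub : (A : Set α) ⊆ (F₀ : Set α) := Finset.coe_subset.2 (hAF₀.trans Finset.inter_subset_left)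
      have := (M.isRkFinite_of_finite (Finset.finite_toSet A)).closure_eq_closure_of_subset_of_eRk_ge_eRk hsub
        (by rw [hr, hp.2.2.1])
      rw [this, hfl.closure]
    have h1 := hcl hF.1 hF.2.1 hF.2.2 hp.2.1.1
    have h2 := hcl hF'.1 hF'.2.1 hF'.2.2 hp'.2.1.1
    have : (F : Set α) = (F' : Set α) := by rw [← h1, ← h2]
    rw [Finset.coe_injective this]

/-- **(Rta)** If every rank-`(t − 1)` flat `F` carries `≥ c(|F ∩ G|)` good `t`-subsets (rank `t − 1`, spanning
complement), then `#{|G ∖ S| < t} + Σ_s c(s)·NR (t − 1) s ≤ DF_t`. -/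
theorem DFq_ge_flat_good_rows (G : Finset α) (q : ℕ) {t : ℕ} (ht : 1 ≤ t) (c : ℕ → ℕ)
    (hc : ∀ F ∈ flatsQ M (t - 1), c (F ∩ G).card ≤ (goodSets M G F q t (t - 1)).card) :
    ((Rq M G q).filter (fun S : Finset α => (G \ S).card < t)).card +
      ∑ s ∈ Finset.range (G.card + 1), c s * NR M G (t - 1) s ≤ DFq M G q t := by
  have h1 := DFq_ge_levels_add_rank_le (M := M) G q t
  have h2 := sum_goodSets_le (M := M) G q t (t - 1)
  have h3 : ∑ s ∈ Finset.range (G.card + 1), c s * NR M G (t - 1) s ≤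
      ∑ F ∈ flatsQ M (t - 1), (goodSets M G F q t (t - 1)).card := by
    rw [← sum_flats_fn_eq]
    exact Finset.sum_le_sum hc
  have ht' : ((t - 1 + 1 : ℕ) : ℕ∞) = (t : ℕ∞) := by
    congr 1
    omega
  rw [ht'] at h2
  omega

end PercRepro.Night4
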